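import Literature.NumberTheory.Sieve.DrappeauDispersionSmoothing
import Literature.NumberTheory.Sieve.PowerfulPartDecomposition
import HarnessLib

/-!
# Drappeau 2017, §5.2 — the second reduction of Theorem 5.1: squarefree `n`

Topic `Literature/NumberTheory/Sieve`, companion of `DrappeauDispersion` (Theorem 5.1 of S. Drappeau,
Proc. London Math. Soc. (3) 114 (2017) 684–732 = arXiv:1504.05549, vendored as the named fact
`Literature.NumberTheory.Sieve.Drappeau2017_theorem51`) and of `DrappeauDispersionSmoothing` (the first
reduction).  Everything here is PROVED; no definition and no named fact is introduced.

The printed argument (§5.2, arXiv p. 17): "Let `𝒦` denote the set of squareful numbers.  Factor each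
integer `n` as `n = n'k` with `μ(n')² = 1`, `(n', k) = 1` and `k ∈ 𝒦` … There are only `O(K^{1/2})`
squareful numbers up to `K`, therefore `∑_{k ≥ K, k ∈ 𝒦} 1/k ≪ K^{−1/2}`.  … using the trivial bound
(5.2), we deduce [(5.8)] `∑_q γ(q) ∑∑ α_m β_n 𝔲_R(mn ā₁a₂; q) = ∑_{k ≤ K, k ∈ 𝒦, (k,a₂)=1} ∑_q γ(q)
∑∑_{(n, ka₂)=1} α_m μ(n)² β_{kn} 𝔲_R(mnk ā₁ a₂; q) + O(R x (log x)^{O(1)} K^{−1/2})`. … For each fixed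
`k`, the sequences `(α_m)` and `(k^{−δ} μ(n)² β_{kn})_n` are supported in `m ∈ (M, 2M]` and
`n ∈ (N/k, 2N/k]`.  We apply Proposition 5.3 with `η ← η/2`, `N ← N/k`, `a₂ ← k a₂` … uniformly for
`k ≤ K`, `≪ k^{−1+δ} x (log x)^{O(1)} R^{−1}`.  Note that `∑_{k ∈ 𝒦} k^{−1+δ}` converges … and so we
conclude by the choice `K = R⁴`."

`Drappeau2017.smooth_of_smooth_sqfree` formalises exactly this for the tree's rendering (moduli `s`,
cut-off `Rd`, smooth weight `γ = BFI.bump S Y` of `DrappeauDispersionSmoothing`): the smoothed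
statement with `β` restricted to squarefree integers implies the smoothed statement for general `β`;
combined with the first reduction this gives `Drappeau2017_theorem51_of_smooth_sqfree` — **Theorem 5.1
follows from Proposition 5.3** (for the weights `BFI.bump`).  Deviations, all harmless: the squarefull
part is split at `K = x^κ` (`κ = min(δ₁/4, η/2)`) rather than `R⁴`; `β_{kn}` is normalised by
`τ(k)^{−A}` (so that `|β'_n| ≤ τ(n)^A` holds exactly, via `τ(kn) ≤ τ(k)τ(n)`) rather than `k^{−δ}`;
the tail `k > K` is bounded by (5.2) with the pointwise divisor bound and
`#{n ≤ X : powerfulPart n > K} ≤ 6X/√K` (`PowerfulPartDecomposition`), and the head is summed with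
`∑_{k squarefull} τ(k)^A/k ≤ 9 C_ε^A`.

## References

* S. Drappeau, Proc. London Math. Soc. (3) 114 (2017) 684–732, arXiv:1504.05549, §5.2 (5.7)–(5.8) and
  Proposition 5.3. [cite: Drappeau2017, §5.2 (5.8)]
* É. Fouvry, *Sur le problème des diviseurs de Titchmarsh*, J. reine angew. Math. 357 (1985), §V.2.
  [folklore]
-/

noncomputable section

open Finset Real
open scoped ArithmeticFunction.sigma

namespace Literature.NumberTheory.Sieve

namespace Drappeau2017

open PowerfulPart

/-! ### Small tools -/

/-- `𝔲_R(t; d) = 0` when `t` is not a unit. [folklore] -/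
theorem uR_eq_zero_of_not_isUnit (R : ℝ) {d : ℕ} {t : ZMod d} (ht : ¬IsUnit t) : uR R d t = 0 := by
  unfold uR
  rw [Finset.sum_eq_zero fun χ _ => ?_, mul_zero]
  split_ifs
  · exact MulChar.map_nonunit χ ht
  · rfl

/-- The kernel argument after moving `k` from `n = k u` to `a₂`:
`(m (k u)) ā₁ a₂ = (m u) ā₁ (k a₂)` in `ZMod s`. [folklore] -/
theorem kerArg_mul_eq (s m k u : ℕ) (a₁ a₂ : ℤ) :
    ((m * (k * u) : ℕ) : ZMod s) * ((a₁ : ZMod s))⁻¹ * (a₂ : ZMod s) =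
      ((m * u : ℕ) : ZMod s) * ((a₁ : ZMod s))⁻¹ * ((((k : ℤ) * a₂ : ℤ)) : ZMod s) := by
  push_cast; ring

/-- If `(s, k) ≠ 1` the kernel vanishes: `𝔲_R((m u) ā₁ (k a₂); s) = 0`. [folklore] -/
theorem uR_kerArg_eq_zero_of_not_coprime (R : ℝ) {s k : ℕ} (hsk : ¬IsCoprime (s : ℤ) (k : ℤ))
    (m u : ℕ) (a₁ a₂ : ℤ) :
    uR R s (((m * u : ℕ) : ZMod s) * ((a₁ : ZMod s))⁻¹ * ((((k : ℤ) * a₂ : ℤ)) : ZMod s)) = 0 := by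
  refine uR_eq_zero_of_not_isUnit R fun hunit => hsk ?_
  have hk : IsUnit ((k : ZMod s)) := by
    have h1 : IsUnit ((((k : ℤ) * a₂ : ℤ)) : ZMod s) := isUnit_of_mul_isUnit_right hunit
    push_cast at h1
    exact isUnit_of_mul_isUnit_left h1
  rw [ZMod.isUnit_iff_coprime] at hk
  rw [Nat.isCoprime_iff_coprime]
  exact hk.symm

/-! ### Sorting `n` by its squarefull part -/

/-- The fibre of `powerfulPart` over a squarefull `k ≥ 1` inside `n ∼ N` is `k · {u ∼ N/k : u squarefree,
(k, u) = 1}`. [folklore] -/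
theorem filter_powerfulPart_eq_image {N : ℝ} (hN : 0 ≤ N) {k : ℕ} (hk0 : 0 < k)
    (hk : ∀ p : ℕ, p.Prime → p ∣ k → p ^ 2 ∣ k) :
    (BFI.dyadic N).filter (fun n : ℕ => powerfulPart n = k) =
      ((BFI.dyadic (N / k)).filter (fun u : ℕ => Squarefree u ∧ k.Coprime u)).image (fun u => k * u) := by
  ext n
  rw [Finset.mem_filter, Finset.mem_image]
  constructor
  · rintro ⟨hn, hpn⟩
    refine ⟨exactPart n, ?_, ?_⟩
    · rw [Finset.mem_filter, ← mul_mem_dyadic_iff hN hk0, ← hpn, powerfulPart_mul_exactPart]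
      exact ⟨hn, squarefree_exactPart n, coprime_powerfulPart_exactPart n⟩
    · rw [← hpn, powerfulPart_mul_exactPart]
  · rintro ⟨u, hu, rfl⟩
    rw [Finset.mem_filter] at hu
    exact ⟨(mul_mem_dyadic_iff hN hk0 u).2 hu.1, powerfulPart_mul_eq hk hu.2.1 hu.2.2⟩

/-- **Sorting by the squarefull part** (the decomposition `n = k n'` of §5.2): for any `G`,
`∑_{n ∼ N, powerfulPart n ≤ K} G(n) = ∑_{k ≤ K squarefull} ∑_{u ∼ N/k, u squarefree, (k,u)=1} G(k u)`.
[cite: Drappeau2017, §5.2 (5.8)] -/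
theorem sum_dyadic_ite_powerfulPart_le_eq (G : ℕ → ℂ) {N : ℝ} (hN : 0 ≤ N) (K : ℝ) :
    ∑ n ∈ BFI.dyadic N, (if (powerfulPart n : ℝ) ≤ K then G n else 0) =
      ∑ k ∈ (Icc 1 ⌊K⌋₊).filter (fun k : ℕ => ∀ p ∈ k.primeFactors, p ^ 2 ∣ k),
        ∑ u ∈ (BFI.dyadic (N / k)).filter (fun u : ℕ => Squarefree u ∧ k.Coprime u), G (k * u) := by
  rw [← Finset.sum_filter]
  set D := (BFI.dyadic N).filter (fun n : ℕ => (powerfulPart n : ℝ) ≤ K) with hD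
  set Kset := (Icc 1 ⌊K⌋₊).filter (fun k : ℕ => ∀ p ∈ k.primeFactors, p ^ 2 ∣ k) with hKset
  have hmaps : ∀ n ∈ D, powerfulPart n ∈ Kset := by
    intro n hn
    rw [hD, Finset.mem_filter] at hn
    have hn0 : n ≠ 0 := by
      have := ((BFI.mem_dyadic hN).1 hn.1).1
      rintro rfl; simp at this; linarith
    rw [hKset, Finset.mem_filter, Finset.mem_Icc]
    refine ⟨⟨powerfulPart_pos hn0, Nat.le_floor hn.2⟩, fun p hp => ?_⟩
    exact sq_dvd_powerfulPart_of_dvd (Nat.prime_of_mem_primeFactors hp) (Nat.dvd_of_mem_primeFactors hp)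
  rw [← Finset.sum_fiberwise_of_maps_to hmaps]
  refine Finset.sum_congr rfl fun k hk => ?_
  rw [hKset, Finset.mem_filter, Finset.mem_Icc] at hk
  have hk0 : 0 < k := hk.1.1
  have hksq : ∀ p : ℕ, p.Prime → p ∣ k → p ^ 2 ∣ k := fun p hp hpk =>
    hk.2 p ((Nat.mem_primeFactors_of_ne_zero (by omega)).2 ⟨hp, hpk⟩)
  -- the fibre inside `D` is the fibre inside `dyadic N`
  have hK1 : 1 ≤ K := Nat.floor_pos.1 (by omega)
  have hkK : (k : ℝ) ≤ K := le_trans (by exact_mod_cast hk.1.2) (Nat.floor_le (by linarith))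
  have hfib : D.filter (fun n => powerfulPart n = k) =
      (BFI.dyadic N).filter (fun n => powerfulPart n = k) := by
    rw [hD, Finset.filter_filter]
    refine Finset.filter_congr fun n _ => ⟨fun h => h.2, fun h => ⟨?_, h⟩⟩
    rw [h]; exact hkK
  rw [hfib, filter_powerfulPart_eq_image hN hk0 hksq, Finset.sum_image]
  intro u _ u' _ h
  exact Nat.eq_of_mul_eq_mul_left hk0 h

/-- The `u`-sum for a fixed squarefull `k` with `(k, a₂) = 1`: the conditions "`u` squarefree,
`(k, u) = 1`, `(k u, a₂) = 1`" are "`(u, k a₂) = 1`" plus "`u` squarefree". [folklore] -/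
theorem sum_filter_sqf_coprime_eq {k : ℕ} {a₂ : ℤ} (hka : IsCoprime (k : ℤ) a₂) (D : Finset ℕ)
    (F : ℕ → ℂ) :
    ∑ u ∈ D.filter (fun u : ℕ => Squarefree u ∧ k.Coprime u),
        (if IsCoprime ((k * u : ℕ) : ℤ) a₂ then F u else 0) =
      ∑ u ∈ D.filter (fun u : ℕ => IsCoprime (u : ℤ) ((k : ℤ) * a₂)),
        (if Squarefree u then F u else 0) := by
  rw [Finset.sum_filter, Finset.sum_filter]
  refine Finset.sum_congr rfl fun u _ => ?_
  have h1 : IsCoprime ((k * u : ℕ) : ℤ) a₂ ↔ IsCoprime (u : ℤ) a₂ := by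
    push_cast
    rw [IsCoprime.mul_left_iff]
    exact ⟨fun h => h.2, fun h => ⟨hka, h⟩⟩
  have h2 : IsCoprime (u : ℤ) ((k : ℤ) * a₂) ↔ k.Coprime u ∧ IsCoprime (u : ℤ) a₂ := by
    rw [IsCoprime.mul_right_iff, Nat.coprime_comm, ← Nat.isCoprime_iff_coprime]
  simp only [h1, h2]
  by_cases hs : Squarefree u <;> by_cases hc : k.Coprime u <;> by_cases hu : IsCoprime (u : ℤ) a₂ <;>
    simp [hs, hc, hu]

/-- Restricting the moduli to `(s, k) = 1` is free: the kernel `𝔲_R((m u) ā₁ (k a₂); s)` vanishes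
otherwise. [folklore] -/
theorem sum_filter_moduli_eq (R : ℝ) (T : Finset ℕ) (w : ℕ → ℂ) (k : ℕ) (a₁ a₂ : ℤ) (ℳ U : Finset ℕ)
    (c : ℕ → ℕ → ℂ) :
    ∑ s ∈ T.filter (fun s : ℕ => IsCoprime (s : ℤ) (a₁ * a₂)), w s *
        ∑ m ∈ ℳ, ∑ u ∈ U, c m u *
          uR R s (((m * u : ℕ) : ZMod s) * ((a₁ : ZMod s))⁻¹ * ((((k : ℤ) * a₂ : ℤ)) : ZMod s)) =
      ∑ s ∈ T.filter (fun s : ℕ => IsCoprime (s : ℤ) (a₁ * ((k : ℤ) * a₂))), w s *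
        ∑ m ∈ ℳ, ∑ u ∈ U, c m u *
          uR R s (((m * u : ℕ) : ZMod s) * ((a₁ : ZMod s))⁻¹ * ((((k : ℤ) * a₂ : ℤ)) : ZMod s)) := by
  rw [Finset.sum_filter, Finset.sum_filter]
  refine Finset.sum_congr rfl fun s _ => ?_
  have hiff : IsCoprime (s : ℤ) (a₁ * ((k : ℤ) * a₂)) ↔
      IsCoprime (s : ℤ) (a₁ * a₂) ∧ IsCoprime (s : ℤ) (k : ℤ) := by
    rw [IsCoprime.mul_right_iff, IsCoprime.mul_right_iff, IsCoprime.mul_right_iff]; tauto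
  by_cases h1 : IsCoprime (s : ℤ) (a₁ * a₂)
  · by_cases h2 : IsCoprime (s : ℤ) (k : ℤ)
    · rw [if_pos h1, if_pos (hiff.2 ⟨h1, h2⟩)]
    · rw [if_pos h1, if_neg (fun h => h2 (hiff.1 h).2)]
      rw [Finset.sum_eq_zero fun m _ => Finset.sum_eq_zero fun u _ => ?_, mul_zero]
      rw [uR_kerArg_eq_zero_of_not_coprime R h2, mul_zero]
  · rw [if_neg h1, if_neg (fun h => h1 (hiff.1 h).1)]

/-! ### The tail `powerfulPart n > K` -/

/-- **The tail of the squarefull part** (the `O(R x (log x)^{O(1)} K^{−1/2})` of (5.8), here with the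
pointwise divisor bound `τ ≤ E`): the `γ`-weighted sum with `β` restricted to `powerfulPart n > K` is at
most `E^{2A+2} Rd (12 N/√K)(32 M + 4 S)`, by the trivial bound (5.2) at each modulus and
`#{n ≤ 2N : powerfulPart n > K} ≤ 12 N/√K`. [cite: Drappeau2017, §5.2 (5.8)] -/
theorem norm_smoothSum_tail_le {M N S Y Rd K E Aτ : ℝ} (hM : 0 < M) (hN : 0 < N) (hS : 1 ≤ S)
    (hY : 0 < Y) (hYS : Y ≤ S / 2) (hRd : 1 ≤ Rd) (hK : 0 < K) (hE : 1 ≤ E) (hA : 0 ≤ Aτ)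
    (hτM : ∀ m ∈ BFI.dyadic M, (σ 0 m : ℝ) ≤ E) (hτN : ∀ n ∈ BFI.dyadic N, (σ 0 n : ℝ) ≤ E)
    (hτS : ∀ s ∈ BFI.mRange S Y, (σ 0 s : ℝ) ≤ E) (a₁ a₂ : ℤ) {α β : ℕ → ℂ}
    (hα : ∀ m, ‖α m‖ ≤ (σ 0 m : ℝ) ^ Aτ) (hβ : ∀ n, ‖β n‖ ≤ (σ 0 n : ℝ) ^ Aτ)
    (P : ℕ → Prop) [DecidablePred P] :
    ‖∑ s ∈ (BFI.mRange S Y).filter P, ((BFI.bump S Y s : ℝ) : ℂ) *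
        ∑ m ∈ BFI.dyadic M, ∑ n ∈ (BFI.dyadic N).filter (fun n : ℕ => IsCoprime (n : ℤ) a₂),
          α m * (if (powerfulPart n : ℝ) ≤ K then 0 else β n) *
            uR Rd s (((m * n : ℕ) : ZMod s) * ((a₁ : ZMod s))⁻¹ * (a₂ : ZMod s))‖ ≤
      E ^ Aτ * E ^ Aτ * (E * E) * Rd * (12 * N / Real.sqrt K) * (32 * M + 4 * S) := by
  have hS0 : 0 < S := by linarith
  have hRd0 : 0 < Rd := by linarith
  have hE0 : 0 < E := by linarith
  have hEA0 : 0 ≤ E ^ Aτ := by positivity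
  set ℳ := BFI.dyadic M with hℳ
  set 𝒩 := (BFI.dyadic N).filter (fun n : ℕ => IsCoprime (n : ℤ) a₂) with h𝒩
  set 𝒩₂ := 𝒩.filter (fun n : ℕ => ¬((powerfulPart n : ℝ) ≤ K)) with h𝒩₂
  set mR := BFI.mRange S Y with hmR
  -- the count of the tail
  have hcard₂ : (𝒩₂.card : ℝ) ≤ 12 * N / Real.sqrt K := by
    have hsub : 𝒩₂ ⊆ (Icc 1 ⌊2 * N⌋₊).filter (fun n : ℕ => K < (powerfulPart n : ℝ)) := by
      intro n hn
      rw [h𝒩₂, Finset.mem_filter, h𝒩, Finset.mem_filter] at hn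
      have hn' := (BFI.mem_dyadic hN.le).1 hn.1.1
      rw [Finset.mem_filter, Finset.mem_Icc]
      refine ⟨⟨?_, Nat.le_floor hn'.2⟩, not_le.1 hn.2⟩
      have : (0 : ℝ) < n := hN.trans hn'.1
      exact_mod_cast this
    calc (𝒩₂.card : ℝ) ≤ #((Icc 1 ⌊2 * N⌋₊).filter (fun n : ℕ => K < (powerfulPart n : ℝ))) := by
          exact_mod_cast Finset.card_le_card hsub
      _ ≤ 6 * (⌊2 * N⌋₊ : ℕ) / Real.sqrt K := card_filter_lt_powerfulPart_le _ hK
      _ ≤ 6 * (2 * N) / Real.sqrt K := by gcongr; exact Nat.floor_le (by linarith)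
      _ = 12 * N / Real.sqrt K := by ring
  have hcardℳ : (ℳ.card : ℝ) ≤ 2 * M := card_dyadic_le hM.le
  have hcardmR : (mR.card : ℝ) ≤ 4 * S := by
    rw [hmR, BFI.mRange, Finset.card_range]
    push_cast
    have := Nat.floor_le (show (0 : ℝ) ≤ 2 * S + Y by linarith)
    linarith
  -- the bound at one modulus
  have hterm : ∀ s ∈ mR.filter P,
      ‖((BFI.bump S Y s : ℝ) : ℂ) * ∑ m ∈ ℳ, ∑ n ∈ 𝒩,
          α m * (if (powerfulPart n : ℝ) ≤ K then 0 else β n) *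
            uR Rd s (((m * n : ℕ) : ZMod s) * ((a₁ : ZMod s))⁻¹ * (a₂ : ZMod s))‖ ≤
        E ^ Aτ * E ^ Aτ * (E * E) * Rd * (12 * N / Real.sqrt K) * (8 * M / S + 1) := by
    intro s hs
    have hs_mR : s ∈ mR := (Finset.mem_filter.1 hs).1
    have hbound0 : 0 ≤ E ^ Aτ * E ^ Aτ * (E * E) * Rd * (12 * N / Real.sqrt K) * (8 * M / S + 1) := by
      positivity
    by_cases hb : BFI.bump S Y s = 0
    · rw [hb]; simpa using hbound0
    -- `s` is in the support of `γ`: `s > S - Y ≥ S/2`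
    have hsY : S - Y < s := by
      by_contra h
      exact hb (BFI.bump_eq_zero_of_le hY hS0.le (not_lt.1 h))
    have hsS : S / 2 < s := by linarith
    have hs0' : (0 : ℝ) < s := by linarith
    have hs0 : 0 < s := by exact_mod_cast hs0'
    -- restrict `n` to the tail
    have hinner : ∑ m ∈ ℳ, ∑ n ∈ 𝒩, α m * (if (powerfulPart n : ℝ) ≤ K then 0 else β n) *
          uR Rd s (((m * n : ℕ) : ZMod s) * ((a₁ : ZMod s))⁻¹ * (a₂ : ZMod s)) =
        ∑ m ∈ ℳ, ∑ n ∈ 𝒩₂, α m * β n *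
          uR Rd s (((m * n : ℕ) : ZMod s) * ((a₁ : ZMod s))⁻¹ * (a₂ : ZMod s)) := by
      refine Finset.sum_congr rfl fun m _ => ?_
      rw [h𝒩₂, Finset.sum_filter (fun n : ℕ => ¬((powerfulPart n : ℝ) ≤ K))]
      refine Finset.sum_congr rfl fun n _ => ?_
      split_ifs <;> simp
    have hα' : ∀ m ∈ ℳ, ‖α m‖ ≤ E ^ Aτ := fun m hm =>
      (hα m).trans (Real.rpow_le_rpow (Nat.cast_nonneg _) (hτM m hm) hA)
    have hβ' : ∀ n ∈ 𝒩₂, ‖β n‖ ≤ E ^ Aτ := by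
      intro n hn
      have hn' : n ∈ BFI.dyadic N :=
        (Finset.mem_filter.1 (Finset.mem_filter.1 hn).1).1
      exact (hβ n).trans (Real.rpow_le_rpow (Nat.cast_nonneg _) (hτN n hn') hA)
    have h1 := norm_bilinear_uR_le hM.le 𝒩₂ hs0 hRd0.le a₁ a₂ hEA0 hEA0 hα' hβ'
    have hq : (((⌊2 * M⌋₊ / s : ℕ) : ℝ) + 1) ≤ 4 * M / S + 1 := by
      refine add_le_add ?_ le_rfl
      calc (((⌊2 * M⌋₊ / s : ℕ) : ℝ)) ≤ (⌊2 * M⌋₊ : ℝ) / s := Nat.cast_div_le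
        _ ≤ 2 * M / s := div_le_div_of_nonneg_right (Nat.floor_le (by linarith)) hs0'.le
        _ ≤ 2 * M / (S / 2) := div_le_div_of_nonneg_left (by linarith) (by linarith) hsS.le
        _ = 4 * M / S := by field_simp; ring
    have hφ : Rd * (σ 0 s : ℝ) / (Nat.totient s : ℝ) ≤ Rd * (E * E) * (2 / S) := by
      have h2 := inv_totient_le_sigma_zero_div s
      have hτs := hτS s hs_mR
      have hσ0 : (0 : ℝ) ≤ (σ 0 s : ℝ) := Nat.cast_nonneg _
      calc Rd * (σ 0 s : ℝ) / (Nat.totient s : ℝ) = Rd * ((σ 0 s : ℝ) * ((Nat.totient s : ℝ))⁻¹) := by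
            ring
        _ ≤ Rd * ((σ 0 s : ℝ) * ((σ 0 s : ℝ) / s)) :=
            mul_le_mul_of_nonneg_left (mul_le_mul_of_nonneg_left h2 hσ0) hRd0.le
        _ = Rd * ((σ 0 s : ℝ) * (σ 0 s : ℝ)) * (1 / s) := by ring
        _ ≤ Rd * (E * E) * (2 / S) := by
            refine mul_le_mul (mul_le_mul_of_nonneg_left (mul_le_mul hτs hτs hσ0 hE0.le) hRd0.le)
              ?_ (by positivity) (by positivity)
            rw [div_le_div_iff₀ hs0' hS0]; linarith
    have hγ1 : ‖((BFI.bump S Y s : ℝ) : ℂ)‖ ≤ 1 := by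
      rw [Complex.norm_real, Real.norm_eq_abs]; exact BFI.abs_bump_le_one hY hS0.le _
    rw [norm_mul, hinner]
    calc ‖((BFI.bump S Y s : ℝ) : ℂ)‖ * ‖∑ m ∈ ℳ, ∑ n ∈ 𝒩₂, α m * β n *
            uR Rd s (((m * n : ℕ) : ZMod s) * ((a₁ : ZMod s))⁻¹ * (a₂ : ZMod s))‖
        ≤ 1 * (E ^ Aτ * E ^ Aτ * ((𝒩₂.card : ℝ) * (((⌊2 * M⌋₊ / s : ℕ) : ℝ) + 1) +
            Rd * (σ 0 s : ℝ) / (Nat.totient s : ℝ) * ((ℳ.card : ℝ) * 𝒩₂.card))) :=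
          mul_le_mul hγ1 h1 (norm_nonneg _) zero_le_one
      _ ≤ 1 * (E ^ Aτ * E ^ Aτ * ((12 * N / Real.sqrt K) * (4 * M / S + 1) +
            Rd * (E * E) * (2 / S) * ((2 * M) * (12 * N / Real.sqrt K)))) := by
          refine mul_le_mul_of_nonneg_left (mul_le_mul_of_nonneg_left (add_le_add ?_ ?_)
            (by positivity)) zero_le_one
          · exact mul_le_mul hcard₂ hq (by positivity) (by positivity)
          · exact mul_le_mul hφ (mul_le_mul hcardℳ hcard₂ (by positivity) (by positivity))
              (by positivity) (by positivity)
      _ = E ^ Aτ * E ^ Aτ * (12 * N / Real.sqrt K) * ((4 * M / S + 1) + Rd * (E * E) * (4 * M / S)) := by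
          ring
      _ ≤ E ^ Aτ * E ^ Aτ * (12 * N / Real.sqrt K) *
            ((E * E) * Rd * (4 * M / S + 1) + Rd * (E * E) * (4 * M / S)) := by
          refine mul_le_mul_of_nonneg_left (add_le_add ?_ le_rfl) (by positivity)
          have h0 : 0 ≤ 4 * M / S + 1 := by positivity
          calc 4 * M / S + 1 = 1 * 1 * (4 * M / S + 1) := by ring
            _ ≤ (E * E) * Rd * (4 * M / S + 1) := by
                refine mul_le_mul_of_nonneg_right ?_ h0
                exact mul_le_mul ((one_mul (1:ℝ)).symm.le.trans (mul_le_mul hE hE zero_le_one hE0.le))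
                  hRd zero_le_one (by positivity)
      _ = E ^ Aτ * E ^ Aτ * (E * E) * Rd * (12 * N / Real.sqrt K) * (8 * M / S + 1) := by ring
  -- summing over the moduli
  calc ‖∑ s ∈ mR.filter P, ((BFI.bump S Y s : ℝ) : ℂ) * ∑ m ∈ ℳ, ∑ n ∈ 𝒩,
          α m * (if (powerfulPart n : ℝ) ≤ K then 0 else β n) *
            uR Rd s (((m * n : ℕ) : ZMod s) * ((a₁ : ZMod s))⁻¹ * (a₂ : ZMod s))‖
      ≤ ∑ s ∈ mR.filter P, ‖((BFI.bump S Y s : ℝ) : ℂ) * ∑ m ∈ ℳ, ∑ n ∈ 𝒩,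
          α m * (if (powerfulPart n : ℝ) ≤ K then 0 else β n) *
            uR Rd s (((m * n : ℕ) : ZMod s) * ((a₁ : ZMod s))⁻¹ * (a₂ : ZMod s))‖ := norm_sum_le _ _
    _ ≤ (mR.filter P).card • (E ^ Aτ * E ^ Aτ * (E * E) * Rd * (12 * N / Real.sqrt K) * (8 * M / S + 1)) :=
        Finset.sum_le_card_nsmul _ _ _ hterm
    _ ≤ (4 * S) * (E ^ Aτ * E ^ Aτ * (E * E) * Rd * (12 * N / Real.sqrt K) * (8 * M / S + 1)) := by
        rw [nsmul_eq_mul]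
        refine mul_le_mul_of_nonneg_right ?_ (by positivity)
        exact le_trans (by exact_mod_cast Finset.card_filter_le _ _) hcardmR
    _ = E ^ Aτ * E ^ Aτ * (E * E) * Rd * (12 * N / Real.sqrt K) * (32 * M + 4 * S) := by
        field_simp; ring

/-! ### The head `powerfulPart n = k ≤ K` -/

/-- For a squarefull `k` NOT coprime to `a₂` the `k`-term of (5.8) vanishes (no `u` has
`(ku, a₂) = 1`). [folklore] -/
theorem head_term_eq_zero {k : ℕ} {a₂ : ℤ} (hka : ¬IsCoprime (k : ℤ) a₂) (Rd : ℝ) (T ℳ D' : Finset ℕ)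
    (w : ℕ → ℂ) (a₁ : ℤ) (α β : ℕ → ℂ) :
    ∑ s ∈ T, w s * ∑ m ∈ ℳ, ∑ u ∈ D'.filter (fun u : ℕ => Squarefree u ∧ k.Coprime u),
        (if IsCoprime ((k * u : ℕ) : ℤ) a₂ then α m * β (k * u) *
          uR Rd s (((m * (k * u) : ℕ) : ZMod s) * ((a₁ : ZMod s))⁻¹ * (a₂ : ZMod s)) else 0) = 0 := by
  refine Finset.sum_eq_zero fun s _ => ?_
  rw [Finset.sum_eq_zero fun m _ => Finset.sum_eq_zero fun u _ => ?_, mul_zero]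
  rw [if_neg]
  intro h
  push_cast at h
  exact hka (IsCoprime.of_mul_left_left h)

/-- **The `k`-term of (5.8) is a normalised instance of the smoothed sum**: for `k` squarefull with
`(k, a₂) = 1` and `τA ≠ 0`, the `k`-term equals `τA` times the `γ`-weighted sum with data
`N ← N/k`, `a₂ ← k a₂`, `β'_u = μ²(u) β_{ku}/τA`; the moduli not coprime to `k` contribute nothing.
[cite: Drappeau2017, §5.2 (5.8)] -/
theorem head_term_eq {k : ℕ} {a₂ : ℤ} (hka : IsCoprime (k : ℤ) a₂) (Rd : ℝ) (T ℳ D' : Finset ℕ)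
    (w : ℕ → ℂ) (a₁ : ℤ) (α β : ℕ → ℂ) {τA : ℝ} (hτA : τA ≠ 0) :
    ∑ s ∈ T.filter (fun s : ℕ => IsCoprime (s : ℤ) (a₁ * a₂)), w s *
        ∑ m ∈ ℳ, ∑ u ∈ D'.filter (fun u : ℕ => Squarefree u ∧ k.Coprime u),
          (if IsCoprime ((k * u : ℕ) : ℤ) a₂ then α m * β (k * u) *
            uR Rd s (((m * (k * u) : ℕ) : ZMod s) * ((a₁ : ZMod s))⁻¹ * (a₂ : ZMod s)) else 0) =
      (τA : ℂ) * ∑ s ∈ T.filter (fun s : ℕ => IsCoprime (s : ℤ) (a₁ * ((k : ℤ) * a₂))), w s *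
        ∑ m ∈ ℳ, ∑ u ∈ D'.filter (fun u : ℕ => IsCoprime (u : ℤ) ((k : ℤ) * a₂)),
          α m * ((if Squarefree u then β (k * u) else 0) * (((τA⁻¹ : ℝ)) : ℂ)) *
            uR Rd s (((m * u : ℕ) : ZMod s) * ((a₁ : ZMod s))⁻¹ * ((((k : ℤ) * a₂ : ℤ)) : ZMod s)) := by
  set c : ℕ → ℕ → ℂ := fun m u => if Squarefree u then α m * β (k * u) else 0 with hc
  have hL : ∀ s : ℕ, ∀ m ∈ ℳ,
      ∑ u ∈ D'.filter (fun u : ℕ => Squarefree u ∧ k.Coprime u),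
          (if IsCoprime ((k * u : ℕ) : ℤ) a₂ then α m * β (k * u) *
            uR Rd s (((m * (k * u) : ℕ) : ZMod s) * ((a₁ : ZMod s))⁻¹ * (a₂ : ZMod s)) else 0) =
        ∑ u ∈ D'.filter (fun u : ℕ => IsCoprime (u : ℤ) ((k : ℤ) * a₂)), c m u *
          uR Rd s (((m * u : ℕ) : ZMod s) * ((a₁ : ZMod s))⁻¹ * ((((k : ℤ) * a₂ : ℤ)) : ZMod s)) := by
    intro s m _
    simp only [kerArg_mul_eq]
    rw [sum_filter_sqf_coprime_eq hka D' (fun u => α m * β (k * u) *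
      uR Rd s (((m * u : ℕ) : ZMod s) * ((a₁ : ZMod s))⁻¹ * ((((k : ℤ) * a₂ : ℤ)) : ZMod s)))]
    refine Finset.sum_congr rfl fun u _ => ?_
    rw [hc]
    dsimp only
    split_ifs <;> simp
  have hR : ∀ s : ℕ, ∀ m ∈ ℳ,
      ∑ u ∈ D'.filter (fun u : ℕ => IsCoprime (u : ℤ) ((k : ℤ) * a₂)),
          (τA : ℂ) * (α m * ((if Squarefree u then β (k * u) else 0) * (((τA⁻¹ : ℝ)) : ℂ)) *
            uR Rd s (((m * u : ℕ) : ZMod s) * ((a₁ : ZMod s))⁻¹ * ((((k : ℤ) * a₂ : ℤ)) : ZMod s))) =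
        ∑ u ∈ D'.filter (fun u : ℕ => IsCoprime (u : ℤ) ((k : ℤ) * a₂)), c m u *
          uR Rd s (((m * u : ℕ) : ZMod s) * ((a₁ : ZMod s))⁻¹ * ((((k : ℤ) * a₂ : ℤ)) : ZMod s)) := by
    intro s m _
    refine Finset.sum_congr rfl fun u _ => ?_
    have hτ : (τA : ℂ) * (((τA⁻¹ : ℝ)) : ℂ) = 1 := by
      rw [Complex.ofReal_inv, mul_inv_cancel₀ (Complex.ofReal_ne_zero.2 hτA)]
    rw [hc]
    dsimp only
    split_ifs
    · calc (τA : ℂ) * (α m * (β (k * u) * (((τA⁻¹ : ℝ)) : ℂ)) * uR Rd s _)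
          = ((τA : ℂ) * (((τA⁻¹ : ℝ)) : ℂ)) * (α m * β (k * u) * uR Rd s _) := by ring
        _ = _ := by rw [hτ, one_mul]
    · simp
  rw [Finset.sum_congr rfl fun s _ => congrArg (fun z => w s * z) (Finset.sum_congr rfl (hL s)),
    sum_filter_moduli_eq Rd T w k a₁ a₂ ℳ _ c, Finset.mul_sum]
  refine Finset.sum_congr rfl fun s _ => ?_
  have e1 : (τA : ℂ) * ∑ m ∈ ℳ, ∑ u ∈ D'.filter (fun u : ℕ => IsCoprime (u : ℤ) ((k : ℤ) * a₂)),
      α m * ((if Squarefree u then β (k * u) else 0) * (((τA⁻¹ : ℝ)) : ℂ)) *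
        uR Rd s (((m * u : ℕ) : ZMod s) * ((a₁ : ZMod s))⁻¹ * ((((k : ℤ) * a₂ : ℤ)) : ZMod s)) =
      ∑ m ∈ ℳ, ∑ u ∈ D'.filter (fun u : ℕ => IsCoprime (u : ℤ) ((k : ℤ) * a₂)), c m u *
        uR Rd s (((m * u : ℕ) : ZMod s) * ((a₁ : ZMod s))⁻¹ * ((((k : ℤ) * a₂ : ℤ)) : ZMod s)) := by
    rw [Finset.mul_sum]
    refine Finset.sum_congr rfl fun m hm => ?_
    rw [Finset.mul_sum]
    exact hR s m hm
  rw [mul_left_comm, e1]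

set_option maxHeartbeats 400000 in
open PowerfulPart in
/-- **Drappeau 2017, §5.2, second reduction: it suffices to treat `β` supported on squarefree
integers.**  If the smoothed statement (the hypothesis of `Drappeau2017_theorem51_of_smooth`, i.e.
(5.6)/Proposition 5.3 for the weights `γ = BFI.bump S Y`) holds for all `β` supported on squarefree
integers, then it holds for all `β`: sort `n = k u` by its squarefull part `k = powerfulPart n`
(`PowerfulPartDecomposition`); for `k ≤ K = x^κ` (`κ = min(δ₁/4, η/2)`, `δ₁ = min(δ, 1/100)`) the
`k`-term is `τ(k)^A` times an instance of the hypothesis with `x ← x/k`, `N ← N/k`, `a₂ ← k a₂`,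
`η ← η/2`, `β'_u = μ²(u) β_{ku}/τ(k)^A` (`head_term_eq`), giving `≪ τ(k)^A k^{−1} x (log x)^{c₀}/Rd`,
summed with `∑_{k squarefull} τ(k)^A/k ≤ 9 C_ε^A`; the tail `k > K` is `≤ 1296 C_ε^{2A+2} x/Rd` by
`norm_smoothSum_tail_le` (trivial bound (5.2), `#{n : powerfulPart n > K} ≤ 12N/√K`, `Rd ≤ x^{κ/16}`).
The resulting `δ` is `κ/16`. [cite: Drappeau2017, §5.2 (5.7)–(5.8)] -/
theorem smooth_of_smooth_sqfree
    (Hsq : ∀ η : ℝ, 0 < η → ∃ δ : ℝ, 0 < δ ∧ ∀ Aτ : ℝ, 0 ≤ Aτ → ∃ C c₀ x₀ : ℝ, ∀ x : ℝ, x₀ ≤ x →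
      ∀ M N S Rd Y : ℝ, M * N = x → x ^ η ≤ N → N ≤ S ^ (2 / 3 - η) → x ^ (1 / 4 : ℝ) ≤ S →
        S ≤ x ^ (1 / 2 + δ) → 1 ≤ Rd → Rd ≤ x ^ δ → S * x ^ (-δ) ≤ Y → Y ≤ S / 4 →
      ∀ a₁ a₂ : ℤ, a₁ ≠ 0 → a₂ ≠ 0 → (|a₁| : ℝ) ≤ x ^ δ → (|a₂| : ℝ) ≤ x ^ δ →
      ∀ α β : ℕ → ℂ, (∀ m, ‖α m‖ ≤ (σ 0 m : ℝ) ^ Aτ) → (∀ n, ‖β n‖ ≤ (σ 0 n : ℝ) ^ Aτ) →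
        (∀ n, ¬Squarefree n → β n = 0) →
        ‖∑ s ∈ (BFI.mRange S Y).filter (fun s : ℕ => IsCoprime (s : ℤ) (a₁ * a₂)),
            ((BFI.bump S Y s : ℝ) : ℂ) *
              ∑ m ∈ BFI.dyadic M, ∑ n ∈ (BFI.dyadic N).filter (fun n : ℕ => IsCoprime (n : ℤ) a₂),
                α m * β n *
                  uR Rd s (((m * n : ℕ) : ZMod s) * ((a₁ : ZMod s))⁻¹ * ((a₂ : ZMod s)))‖ ≤
          C * x * Real.log x ^ c₀ / Rd) :
    ∀ η : ℝ, 0 < η → ∃ δ : ℝ, 0 < δ ∧ ∀ Aτ : ℝ, 0 ≤ Aτ → ∃ C c₀ x₀ : ℝ, ∀ x : ℝ, x₀ ≤ x →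
      ∀ M N S Rd Y : ℝ, M * N = x → x ^ η ≤ N → N ≤ S ^ (2 / 3 - η) → x ^ (1 / 4 : ℝ) ≤ S →
        S ≤ x ^ (1 / 2 + δ) → 1 ≤ Rd → Rd ≤ x ^ δ → S * x ^ (-δ) ≤ Y → Y ≤ S / 4 →
      ∀ a₁ a₂ : ℤ, a₁ ≠ 0 → a₂ ≠ 0 → (|a₁| : ℝ) ≤ x ^ δ → (|a₂| : ℝ) ≤ x ^ δ →
      ∀ α β : ℕ → ℂ, (∀ m, ‖α m‖ ≤ (σ 0 m : ℝ) ^ Aτ) → (∀ n, ‖β n‖ ≤ (σ 0 n : ℝ) ^ Aτ) →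
        ‖∑ s ∈ (BFI.mRange S Y).filter (fun s : ℕ => IsCoprime (s : ℤ) (a₁ * a₂)),
            ((BFI.bump S Y s : ℝ) : ℂ) *
              ∑ m ∈ BFI.dyadic M, ∑ n ∈ (BFI.dyadic N).filter (fun n : ℕ => IsCoprime (n : ℤ) a₂),
                α m * β n *
                  uR Rd s (((m * n : ℕ) : ZMod s) * ((a₁ : ZMod s))⁻¹ * ((a₂ : ZMod s)))‖ ≤
          C * x * Real.log x ^ c₀ / Rd := by
  intro η hη
  obtain ⟨δ', hδ', Hδ⟩ := Hsq (η / 2) (by positivity)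
  set δ₁ : ℝ := min δ' (1 / 100) with hδ₁
  have hδ₁0 : 0 < δ₁ := lt_min hδ' (by norm_num)
  have hδ₁' : δ₁ ≤ δ' := min_le_left _ _
  have hδ₁1 : δ₁ ≤ 1 / 100 := min_le_right _ _
  set κ : ℝ := min (δ₁ / 4) (η / 2) with hκ
  have hκ0 : 0 < κ := lt_min (by positivity) (by positivity)
  have hκδ : κ ≤ δ₁ / 4 := min_le_left _ _
  have hκη : κ ≤ η / 2 := min_le_right _ _
  have hκδ₁ : κ * δ₁ ≤ κ * (1 / 100) := mul_le_mul_of_nonneg_left hδ₁1 hκ0.le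
  refine ⟨κ / 16, by positivity, fun Aτ hAτ => ?_⟩
  obtain ⟨C, c₀, x₀, HC⟩ := Hδ Aτ hAτ
  -- the pointwise divisor bound, exponent `ε = κ / (16 (A + 1))`
  set ε : ℝ := κ / (16 * (Aτ + 1)) with hε
  have hε0 : 0 < ε := by positivity
  obtain ⟨Cτ, hCτ1, hCτ⟩ := exists_sigma_zero_le_mul_rpow hε0
  have hCτ0 : 0 < Cτ := by linarith
  set X₁ : ℝ := (max x₀ 3) ^ 2 with hX₁
  refine ⟨9 * Cτ ^ Aτ * max C 0 + 1296 * Cτ ^ (2 * Aτ + 2), max c₀ 0, X₁,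
    fun x hx M N S Rd Y hMN hN hNS hS hSx hRd1 hRd hY1 hY4 a₁ a₂ ha₁ ha₂ ha₁x ha₂x α β hα hβ => ?_⟩
  -- ### sizes
  have hm3 : (3 : ℝ) ≤ max x₀ 3 := le_max_right _ _
  have hm0 : (0 : ℝ) ≤ max x₀ 3 := by linarith
  have hx9 : 9 ≤ x := by
    have : (3 : ℝ) ^ 2 ≤ (max x₀ 3) ^ 2 := pow_le_pow_left₀ (by norm_num) hm3 2
    rw [hX₁] at hx; linarith
  have hx1 : 1 ≤ x := by linarith
  have hx0 : 0 < x := by linarith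
  have hsqrt : max x₀ 3 ≤ Real.sqrt x := by
    rw [← Real.sqrt_sq hm0]
    exact Real.sqrt_le_sqrt (by rw [hX₁] at hx; exact hx)
  have hsqrt_eq : Real.sqrt x = x ^ (1 / 2 : ℝ) := Real.sqrt_eq_rpow x
  have hL1 : 1 ≤ Real.log x := by
    rw [Real.le_log_iff_exp_le (by linarith)]
    have := Real.exp_one_lt_d9
    linarith
  have hN0 : 0 < N := lt_of_lt_of_le (Real.rpow_pos_of_pos hx0 η) hN
  have hM0 : 0 < M := by
    by_contra h
    have : M * N ≤ 0 := mul_nonpos_of_nonpos_of_nonneg (not_lt.1 h) hN0.le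
    linarith
  have hS0 : 0 < S := lt_of_lt_of_le (Real.rpow_pos_of_pos hx0 _) hS
  have hS1 : 1 ≤ S := le_trans (Real.one_le_rpow hx1 (by norm_num)) hS
  have hRd0 : 0 < Rd := by linarith
  have hY0 : 0 < Y := lt_of_lt_of_le (mul_pos hS0 (Real.rpow_pos_of_pos hx0 _)) hY1
  have hYS2 : Y ≤ S / 2 := by linarith
  have hYS : Y ≤ S := by linarith
  have hmono : ∀ {u v : ℝ}, u ≤ v → x ^ u ≤ x ^ v := fun h => Real.rpow_le_rpow_of_exponent_le hx1 h
  have hle1 : ∀ {u : ℝ}, u ≤ 1 → x ^ u ≤ x := fun h => (hmono h).trans_eq (Real.rpow_one x)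
  have hN1 : 1 ≤ N := le_trans (Real.one_le_rpow hx1 hη.le) hN
  have hMx : M ≤ x := by
    calc M = M * 1 := (mul_one M).symm
      _ ≤ M * N := mul_le_mul_of_nonneg_left hN1 hM0.le
      _ = x := hMN
  have hSx1 : S ≤ x := hSx.trans (hle1 (by linarith))
  have hNS23 : N ≤ S ^ (2 / 3 : ℝ) := hNS.trans (Real.rpow_le_rpow_of_exponent_le hS1 (by linarith))
  have hNx : N ≤ x := by
    refine hNS23.trans ?_
    calc S ^ (2 / 3 : ℝ) ≤ S ^ (1 : ℝ) := Real.rpow_le_rpow_of_exponent_le hS1 (by norm_num)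
      _ = S := Real.rpow_one S
      _ ≤ x := hSx1
  have hNS_le : N * S ≤ x := by
    have h2 : N * S ≤ S ^ (2 / 3 : ℝ) * S := mul_le_mul_of_nonneg_right hNS23 hS0.le
    have h3 : S ^ (2 / 3 : ℝ) * S = S ^ (5 / 3 : ℝ) := by
      rw [← Real.rpow_add_one hS0.ne']; norm_num
    have h4 : S ^ (5 / 3 : ℝ) ≤ (x ^ (1 / 2 + κ / 16)) ^ (5 / 3 : ℝ) :=
      Real.rpow_le_rpow hS0.le hSx (by norm_num)
    rw [← Real.rpow_mul hx0.le] at h4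
    have h5 : x ^ ((1 / 2 + κ / 16) * (5 / 3 : ℝ)) ≤ x := hle1 (by linarith)
    linarith
  -- the cut `K = x^κ` for the squarefull part
  set K : ℝ := x ^ κ with hKdef
  have hK0 : 0 < K := Real.rpow_pos_of_pos hx0 κ
  have hK1 : 1 ≤ K := Real.one_le_rpow hx1 hκ0.le
  have hsqrtK : Real.sqrt K = x ^ (κ / 2) := by
    rw [Real.sqrt_eq_rpow, hKdef, ← Real.rpow_mul hx0.le]; ring_nf
  have hx1κ : x ^ (1 - κ) = x / K := by
    rw [hKdef, Real.rpow_sub hx0, Real.rpow_one]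
  -- uniform divisor bound `τ(j) ≤ E` for `j ≤ 3x`
  set E : ℝ := Cτ * (3 * x) ^ ε with hE
  have h3x1 : 1 ≤ 3 * x := by linarith
  have hE1 : 1 ≤ E := by
    calc (1 : ℝ) = 1 * 1 := by ring
      _ ≤ Cτ * (3 * x) ^ ε := mul_le_mul hCτ1 (Real.one_le_rpow h3x1 hε0.le) zero_le_one hCτ0.le
  have hE0 : 0 < E := by linarith
  have hτE : ∀ j : ℕ, (j : ℝ) ≤ 3 * x → (σ 0 j : ℝ) ≤ E := by
    intro j hj
    calc (σ 0 j : ℝ) ≤ Cτ * (j : ℝ) ^ ε := by exact_mod_cast hCτ j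
      _ ≤ Cτ * (3 * x) ^ ε :=
          mul_le_mul_of_nonneg_left (Real.rpow_le_rpow (Nat.cast_nonneg j) hj hε0.le) hCτ0.le
  have hτM : ∀ m ∈ BFI.dyadic M, (σ 0 m : ℝ) ≤ E := fun m hm =>
    hτE m (((BFI.mem_dyadic hM0.le).1 hm).2.trans (by linarith))
  have hτN : ∀ n ∈ BFI.dyadic N, (σ 0 n : ℝ) ≤ E := fun n hn =>
    hτE n (((BFI.mem_dyadic hN0.le).1 hn).2.trans (by linarith))
  have hτS : ∀ s ∈ BFI.mRange S Y, (σ 0 s : ℝ) ≤ E := by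
    intro s hs
    refine hτE s ?_
    have h1 : (s : ℝ) ≤ ⌊2 * S + Y⌋₊ := by exact_mod_cast BFI.mem_mRange.1 hs
    exact h1.trans ((Nat.floor_le (by linarith)).trans (by linarith))
  have hpow : E ^ Aτ * E ^ Aτ * (E * E) ≤ 3 * Cτ ^ (2 * Aτ + 2) * x ^ (κ / 8) := by
    have h1 : E ^ Aτ * E ^ Aτ * (E * E) = E ^ (2 * Aτ + 2) := by
      rw [show E * E = E ^ (2 : ℝ) by rw [Real.rpow_two]; ring, ← Real.rpow_add hE0,
        ← Real.rpow_add hE0]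
      ring_nf
    have h2 : E ^ (2 * Aτ + 2) = Cτ ^ (2 * Aτ + 2) * (3 * x) ^ (κ / 8) := by
      rw [hE, Real.mul_rpow hCτ0.le (by positivity), ← Real.rpow_mul (by positivity)]
      congr 2
      rw [hε]; field_simp; ring
    have h3 : (3 * x) ^ (κ / 8) ≤ 3 * x ^ (κ / 8) := by
      rw [Real.mul_rpow (by norm_num) hx0.le]
      refine mul_le_mul_of_nonneg_right ?_ (by positivity)
      calc (3 : ℝ) ^ (κ / 8) ≤ (3 : ℝ) ^ (1 : ℝ) :=
            Real.rpow_le_rpow_of_exponent_le (by norm_num) (by linarith)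
        _ = 3 := Real.rpow_one _
    rw [h1, h2]
    calc Cτ ^ (2 * Aτ + 2) * (3 * x) ^ (κ / 8) ≤ Cτ ^ (2 * Aτ + 2) * (3 * x ^ (κ / 8)) :=
          mul_le_mul_of_nonneg_left h3 (by positivity)
      _ = _ := by ring
  -- ### splitting `β` at `powerfulPart n ≤ K`
  have hsplit : ∀ (m n : ℕ) (u : ℂ), α m * β n * u =
      α m * (if (powerfulPart n : ℝ) ≤ K then β n else 0) * u +
        α m * (if (powerfulPart n : ℝ) ≤ K then 0 else β n) * u := by
    intro m n u; split_ifs <;> ring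
  have hSS : ∑ s ∈ (BFI.mRange S Y).filter (fun s : ℕ => IsCoprime (s : ℤ) (a₁ * a₂)),
      ((BFI.bump S Y s : ℝ) : ℂ) *
        ∑ m ∈ BFI.dyadic M, ∑ n ∈ (BFI.dyadic N).filter (fun n : ℕ => IsCoprime (n : ℤ) a₂),
          α m * β n * uR Rd s (((m * n : ℕ) : ZMod s) * ((a₁ : ZMod s))⁻¹ * ((a₂ : ZMod s))) =
      ∑ s ∈ (BFI.mRange S Y).filter (fun s : ℕ => IsCoprime (s : ℤ) (a₁ * a₂)),
        ((BFI.bump S Y s : ℝ) : ℂ) *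
          ∑ m ∈ BFI.dyadic M, ∑ n ∈ (BFI.dyadic N).filter (fun n : ℕ => IsCoprime (n : ℤ) a₂),
            α m * (if (powerfulPart n : ℝ) ≤ K then β n else 0) *
              uR Rd s (((m * n : ℕ) : ZMod s) * ((a₁ : ZMod s))⁻¹ * ((a₂ : ZMod s))) +
      ∑ s ∈ (BFI.mRange S Y).filter (fun s : ℕ => IsCoprime (s : ℤ) (a₁ * a₂)),
        ((BFI.bump S Y s : ℝ) : ℂ) *
          ∑ m ∈ BFI.dyadic M, ∑ n ∈ (BFI.dyadic N).filter (fun n : ℕ => IsCoprime (n : ℤ) a₂),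
            α m * (if (powerfulPart n : ℝ) ≤ K then 0 else β n) *
              uR Rd s (((m * n : ℕ) : ZMod s) * ((a₁ : ZMod s))⁻¹ * ((a₂ : ZMod s))) := by
    rw [← Finset.sum_add_distrib]
    refine Finset.sum_congr rfl fun s _ => ?_
    rw [← mul_add, ← Finset.sum_add_distrib]
    congr 1
    refine Finset.sum_congr rfl fun m _ => ?_
    rw [← Finset.sum_add_distrib]
    exact Finset.sum_congr rfl fun n _ => hsplit m n _
  -- ### the tail
  have htail := norm_smoothSum_tail_le hM0 hN0 hS1 hY0 hYS2 hRd1 hK0 hE1 hAτ hτM hτN hτS a₁ a₂ hα hβ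
    (fun s : ℕ => IsCoprime (s : ℤ) (a₁ * a₂))
  have htail' : E ^ Aτ * E ^ Aτ * (E * E) * Rd * (12 * N / Real.sqrt K) * (32 * M + 4 * S) ≤
      1296 * Cτ ^ (2 * Aτ + 2) * x / Rd := by
    have h2 : (12 * N / Real.sqrt K) * (32 * M + 4 * S) ≤ 432 * x / x ^ (κ / 2) := by
      rw [hsqrtK, div_mul_eq_mul_div, div_le_div_iff_of_pos_right (Real.rpow_pos_of_pos hx0 _)]
      have e : 12 * N * (32 * M + 4 * S) = 384 * (M * N) + 48 * (N * S) := by ring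
      rw [e]; linarith
    have h3 : x ^ (κ / 8) * Rd * (432 * x / x ^ (κ / 2)) ≤ 432 * x / Rd := by
      rw [mul_div_assoc', div_le_div_iff₀ (Real.rpow_pos_of_pos hx0 _) hRd0]
      have hR2 : Rd * Rd ≤ x ^ (κ / 8) := by
        calc Rd * Rd ≤ x ^ (κ / 16) * x ^ (κ / 16) := mul_le_mul hRd hRd hRd0.le (by positivity)
          _ = x ^ (κ / 8) := by rw [← Real.rpow_add hx0]; ring_nf
      have h4 : x ^ (κ / 8) * x ^ (κ / 8) ≤ x ^ (κ / 2) := by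
        rw [← Real.rpow_add hx0]; exact hmono (by linarith)
      calc x ^ (κ / 8) * Rd * (432 * x) * Rd = 432 * x * (x ^ (κ / 8) * (Rd * Rd)) := by ring
        _ ≤ 432 * x * (x ^ (κ / 8) * x ^ (κ / 8)) := by gcongr
        _ ≤ 432 * x * x ^ (κ / 2) := by gcongr
    calc E ^ Aτ * E ^ Aτ * (E * E) * Rd * (12 * N / Real.sqrt K) * (32 * M + 4 * S)
        = (E ^ Aτ * E ^ Aτ * (E * E)) * Rd * ((12 * N / Real.sqrt K) * (32 * M + 4 * S)) := by ring
      _ ≤ (3 * Cτ ^ (2 * Aτ + 2) * x ^ (κ / 8)) * Rd * (432 * x / x ^ (κ / 2)) :=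
          mul_le_mul (mul_le_mul_of_nonneg_right hpow hRd0.le) h2 (by positivity) (by positivity)
      _ = 3 * Cτ ^ (2 * Aτ + 2) * (x ^ (κ / 8) * Rd * (432 * x / x ^ (κ / 2))) := by ring
      _ ≤ 3 * Cτ ^ (2 * Aτ + 2) * (432 * x / Rd) := mul_le_mul_of_nonneg_left h3 (by positivity)
      _ = 1296 * Cτ ^ (2 * Aτ + 2) * x / Rd := by ring
  -- ### the head: sorting by the squarefull part `k ≤ K`
  have hinner : ∀ s m : ℕ,
      ∑ n ∈ (BFI.dyadic N).filter (fun n : ℕ => IsCoprime (n : ℤ) a₂),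
          α m * (if (powerfulPart n : ℝ) ≤ K then β n else 0) *
            uR Rd s (((m * n : ℕ) : ZMod s) * ((a₁ : ZMod s))⁻¹ * ((a₂ : ZMod s))) =
        ∑ k ∈ (Icc 1 ⌊K⌋₊).filter (fun k : ℕ => ∀ p ∈ k.primeFactors, p ^ 2 ∣ k),
          ∑ u ∈ (BFI.dyadic (N / k)).filter (fun u : ℕ => Squarefree u ∧ k.Coprime u),
            (if IsCoprime ((k * u : ℕ) : ℤ) a₂ then α m * β (k * u) *
              uR Rd s (((m * (k * u) : ℕ) : ZMod s) * ((a₁ : ZMod s))⁻¹ * (a₂ : ZMod s)) else 0) := by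
    intro s m
    rw [Finset.sum_filter]
    have hpt : ∀ n : ℕ, (if IsCoprime (n : ℤ) a₂ then
        α m * (if (powerfulPart n : ℝ) ≤ K then β n else 0) *
          uR Rd s (((m * n : ℕ) : ZMod s) * ((a₁ : ZMod s))⁻¹ * ((a₂ : ZMod s))) else 0) =
        (if (powerfulPart n : ℝ) ≤ K then (if IsCoprime (n : ℤ) a₂ then α m * β n *
          uR Rd s (((m * n : ℕ) : ZMod s) * ((a₁ : ZMod s))⁻¹ * ((a₂ : ZMod s))) else 0) else 0) := by
      intro n; split_ifs <;> simp
    rw [Finset.sum_congr rfl fun n _ => hpt n,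
      sum_dyadic_ite_powerfulPart_le_eq (fun n => if IsCoprime (n : ℤ) a₂ then α m * β n *
        uR Rd s (((m * n : ℕ) : ZMod s) * ((a₁ : ZMod s))⁻¹ * ((a₂ : ZMod s))) else 0) hN0.le K]
  have hhead_eq : ∑ s ∈ (BFI.mRange S Y).filter (fun s : ℕ => IsCoprime (s : ℤ) (a₁ * a₂)),
      ((BFI.bump S Y s : ℝ) : ℂ) *
        ∑ m ∈ BFI.dyadic M, ∑ n ∈ (BFI.dyadic N).filter (fun n : ℕ => IsCoprime (n : ℤ) a₂),
          α m * (if (powerfulPart n : ℝ) ≤ K then β n else 0) *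
            uR Rd s (((m * n : ℕ) : ZMod s) * ((a₁ : ZMod s))⁻¹ * ((a₂ : ZMod s))) =
      ∑ k ∈ (Icc 1 ⌊K⌋₊).filter (fun k : ℕ => ∀ p ∈ k.primeFactors, p ^ 2 ∣ k),
        ∑ s ∈ (BFI.mRange S Y).filter (fun s : ℕ => IsCoprime (s : ℤ) (a₁ * a₂)),
          ((BFI.bump S Y s : ℝ) : ℂ) * ∑ m ∈ BFI.dyadic M,
            ∑ u ∈ (BFI.dyadic (N / k)).filter (fun u : ℕ => Squarefree u ∧ k.Coprime u),
              (if IsCoprime ((k * u : ℕ) : ℤ) a₂ then α m * β (k * u) *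
                uR Rd s (((m * (k * u) : ℕ) : ZMod s) * ((a₁ : ZMod s))⁻¹ * (a₂ : ZMod s)) else 0) := by
    have hs : ∀ s : ℕ, ((BFI.bump S Y s : ℝ) : ℂ) *
        ∑ m ∈ BFI.dyadic M, ∑ n ∈ (BFI.dyadic N).filter (fun n : ℕ => IsCoprime (n : ℤ) a₂),
          α m * (if (powerfulPart n : ℝ) ≤ K then β n else 0) *
            uR Rd s (((m * n : ℕ) : ZMod s) * ((a₁ : ZMod s))⁻¹ * ((a₂ : ZMod s))) =
        ∑ k ∈ (Icc 1 ⌊K⌋₊).filter (fun k : ℕ => ∀ p ∈ k.primeFactors, p ^ 2 ∣ k),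
          ((BFI.bump S Y s : ℝ) : ℂ) * ∑ m ∈ BFI.dyadic M,
            ∑ u ∈ (BFI.dyadic (N / k)).filter (fun u : ℕ => Squarefree u ∧ k.Coprime u),
              (if IsCoprime ((k * u : ℕ) : ℤ) a₂ then α m * β (k * u) *
                uR Rd s (((m * (k * u) : ℕ) : ZMod s) * ((a₁ : ZMod s))⁻¹ * (a₂ : ZMod s)) else 0) := by
      intro s
      rw [Finset.sum_congr rfl fun m _ => hinner s m, Finset.sum_comm, Finset.mul_sum]
    rw [Finset.sum_congr rfl fun s _ => hs s, Finset.sum_comm]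
  -- ### the bound for each `k`
  have hJ : ∀ k ∈ (Icc 1 ⌊K⌋₊).filter (fun k : ℕ => ∀ p ∈ k.primeFactors, p ^ 2 ∣ k),
      ‖∑ s ∈ (BFI.mRange S Y).filter (fun s : ℕ => IsCoprime (s : ℤ) (a₁ * a₂)),
          ((BFI.bump S Y s : ℝ) : ℂ) * ∑ m ∈ BFI.dyadic M,
            ∑ u ∈ (BFI.dyadic (N / k)).filter (fun u : ℕ => Squarefree u ∧ k.Coprime u),
              (if IsCoprime ((k * u : ℕ) : ℤ) a₂ then α m * β (k * u) *
                uR Rd s (((m * (k * u) : ℕ) : ZMod s) * ((a₁ : ZMod s))⁻¹ * (a₂ : ZMod s)) else 0)‖ ≤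
        (σ 0 k : ℝ) ^ Aτ * (max C 0 * (x / k) * Real.log x ^ max c₀ 0 / Rd) := by
    intro k hk
    rw [Finset.mem_filter, Finset.mem_Icc] at hk
    have hk1 : 1 ≤ k := hk.1.1
    have hk0' : (0 : ℝ) < k := by exact_mod_cast hk1
    have hk1' : (1 : ℝ) ≤ k := by exact_mod_cast hk1
    have hkK : (k : ℝ) ≤ K := le_trans (by exact_mod_cast hk.1.2) (Nat.floor_le hK0.le)
    have hτk1 : (1 : ℝ) ≤ (σ 0 k : ℝ) := by exact_mod_cast one_le_sigma_zero (by omega : k ≠ 0)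
    have hτA0 : 0 < (σ 0 k : ℝ) ^ Aτ := Real.rpow_pos_of_pos (by linarith) _
    have hbound0 : 0 ≤ (σ 0 k : ℝ) ^ Aτ * (max C 0 * (x / k) * Real.log x ^ max c₀ 0 / Rd) := by
      have : 0 ≤ max C 0 := le_max_right _ _
      positivity
    by_cases hka : IsCoprime (k : ℤ) a₂
    swap
    · rw [head_term_eq_zero hka, norm_zero]; exact hbound0
    rw [head_term_eq hka Rd (BFI.mRange S Y) (BFI.dyadic M) (BFI.dyadic (N / k))
      (fun s => ((BFI.bump S Y s : ℝ) : ℂ)) a₁ α β hτA0.ne', norm_mul, Complex.norm_real,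
      Real.norm_eq_abs, abs_of_pos hτA0]
    refine mul_le_mul_of_nonneg_left ?_ hτA0.le
    -- the data `x/k, M, N/k, S, Rd, Y, a₁, k a₂, α, β'` satisfy the hypotheses with `δ'`
    have hxk_lo : x ^ (1 - κ) ≤ x / k := by
      rw [hx1κ]; exact div_le_div_of_nonneg_left hx0.le hk0' hkK
    have hxk_le : x / k ≤ x := div_le_self hx0.le hk1'
    have hxk_half : Real.sqrt x ≤ x / k := by
      rw [hsqrt_eq]; exact (hmono (by linarith)).trans hxk_lo
    have hxk3 : 3 ≤ x / k := hm3.trans (hsqrt.trans hxk_half)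
    have hxk1 : 1 ≤ x / k := by linarith
    have hxk0 : 0 < x / k := by linarith
    have hxk₀ : x₀ ≤ x / k := (le_max_left _ _).trans (hsqrt.trans hxk_half)
    have hlogk1 : 1 ≤ Real.log (x / k) := by
      rw [Real.le_log_iff_exp_le hxk0]
      have := Real.exp_one_lt_d9
      linarith
    have hlogk : Real.log (x / k) ≤ Real.log x := Real.log_le_log hxk0 hxk_le
    have hpowk : ∀ e : ℝ, 0 ≤ e → x ^ ((1 - κ) * e) ≤ (x / k) ^ e := fun e he => by
      rw [Real.rpow_mul hx0.le]; exact Real.rpow_le_rpow (by positivity) hxk_lo he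
    have hmonok : ∀ {u v : ℝ}, u ≤ v → (x / k) ^ u ≤ (x / k) ^ v := fun h =>
      Real.rpow_le_rpow_of_exponent_le hxk1 h
    have hMN' : M * (N / k) = x / k := by rw [← mul_div_assoc, hMN]
    have hN' : (x / k) ^ (η / 2) ≤ N / k := by
      calc (x / k) ^ (η / 2) ≤ x ^ (η / 2) := Real.rpow_le_rpow hxk0.le hxk_le (by positivity)
        _ ≤ x ^ (η - κ) := hmono (by linarith)
        _ = x ^ η / K := by rw [hKdef, Real.rpow_sub hx0]
        _ ≤ N / K := div_le_div_of_nonneg_right hN hK0.le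
        _ ≤ N / k := div_le_div_of_nonneg_left hN0.le hk0' hkK
    have hNS' : N / k ≤ S ^ (2 / 3 - η / 2) :=
      (div_le_self hN0.le hk1').trans (hNS.trans (Real.rpow_le_rpow_of_exponent_le hS1 (by linarith)))
    have hS' : (x / k) ^ (1 / 4 : ℝ) ≤ S :=
      (Real.rpow_le_rpow hxk0.le hxk_le (by norm_num)).trans hS
    have hSx' : S ≤ (x / k) ^ (1 / 2 + δ') := by
      have hexp₀ : 1 / 2 + κ / 16 ≤ (1 - κ) * (1 / 2 + δ₁) := by
        have e : (1 - κ) * (1 / 2 + δ₁) = 1 / 2 + δ₁ - κ / 2 - κ * δ₁ := by ring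
        rw [e]; linarith
      calc S ≤ x ^ (1 / 2 + κ / 16) := hSx
        _ ≤ x ^ ((1 - κ) * (1 / 2 + δ₁)) := hmono hexp₀
        _ ≤ (x / k) ^ (1 / 2 + δ₁) := hpowk _ (by linarith)
        _ ≤ (x / k) ^ (1 / 2 + δ') := hmonok (by linarith)
    have hexp₁ : κ / 16 ≤ (1 - κ) * δ₁ := by
      have e : (1 - κ) * δ₁ = δ₁ - κ * δ₁ := by ring
      rw [e]; linarith
    have hsmall : x ^ (κ / 16) ≤ (x / k) ^ δ' :=
      (hmono hexp₁).trans ((hpowk _ hδ₁0.le).trans (hmonok hδ₁'))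
    have hRd' : Rd ≤ (x / k) ^ δ' := hRd.trans hsmall
    have ha₁' : (|a₁| : ℝ) ≤ (x / k) ^ δ' := ha₁x.trans hsmall
    have hY1' : S * (x / k) ^ (-δ') ≤ Y := by
      refine le_trans (mul_le_mul_of_nonneg_left ?_ hS0.le) hY1
      calc (x / k) ^ (-δ') ≤ (x / k) ^ (-δ₁) := hmonok (by linarith)
        _ ≤ (x ^ (1 - κ)) ^ (-δ₁) :=
            Real.rpow_le_rpow_of_nonpos (Real.rpow_pos_of_pos hx0 _) hxk_lo (by linarith)
        _ = x ^ (-((1 - κ) * δ₁)) := by rw [← Real.rpow_mul hx0.le]; ring_nf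
        _ ≤ x ^ (-(κ / 16)) := hmono (by linarith)
    have hka0 : (k : ℤ) * a₂ ≠ 0 := mul_ne_zero (by exact_mod_cast (by omega : k ≠ 0)) ha₂
    have hka₂' : |(((k : ℤ) * a₂ : ℤ) : ℝ)| ≤ (x / k) ^ δ' := by
      have h1 : |(((k : ℤ) * a₂ : ℤ) : ℝ)| = (k : ℝ) * |(a₂ : ℝ)| := by
        push_cast
        rw [abs_mul, abs_of_nonneg hk0'.le]
      rw [h1]
      have hexp₂ : κ + κ / 16 ≤ (1 - κ) * δ₁ := by
        have e : (1 - κ) * δ₁ = δ₁ - κ * δ₁ := by ring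
        rw [e]; linarith
      calc (k : ℝ) * |(a₂ : ℝ)| ≤ K * x ^ (κ / 16) := mul_le_mul hkK ha₂x (by positivity) hK0.le
        _ = x ^ (κ + κ / 16) := by rw [hKdef, ← Real.rpow_add hx0]
        _ ≤ x ^ ((1 - κ) * δ₁) := hmono hexp₂
        _ ≤ (x / k) ^ δ₁ := hpowk _ hδ₁0.le
        _ ≤ (x / k) ^ δ' := hmonok hδ₁'
    -- the normalised sequence `β'`
    have hβ' : ∀ n : ℕ, ‖(if Squarefree n then β (k * n) else 0) *
        (((((σ 0 k : ℝ) ^ Aτ)⁻¹ : ℝ)) : ℂ)‖ ≤ (σ 0 n : ℝ) ^ Aτ := by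
      intro n
      by_cases hn : Squarefree n
      · rw [if_pos hn, norm_mul, Complex.norm_real, Real.norm_eq_abs, abs_of_pos (inv_pos.2 hτA0)]
        have hn0 : n ≠ 0 := hn.ne_zero
        have h1 : ‖β (k * n)‖ ≤ ((σ 0 k : ℝ) * (σ 0 n : ℝ)) ^ Aτ := by
          refine (hβ (k * n)).trans (Real.rpow_le_rpow (Nat.cast_nonneg _) ?_ hAτ)
          exact_mod_cast sigma_zero_mul_le k n
        rw [Real.mul_rpow (by positivity) (Nat.cast_nonneg _)] at h1
        calc ‖β (k * n)‖ * ((σ 0 k : ℝ) ^ Aτ)⁻¹ ≤ ((σ 0 k : ℝ) ^ Aτ * (σ 0 n : ℝ) ^ Aτ) * ((σ 0 k : ℝ) ^ Aτ)⁻¹ :=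
              mul_le_mul_of_nonneg_right h1 (inv_pos.2 hτA0).le
          _ = (σ 0 n : ℝ) ^ Aτ := by field_simp
      · rw [if_neg hn, zero_mul, norm_zero]; positivity
    have hβ's : ∀ n : ℕ, ¬Squarefree n → (if Squarefree n then β (k * n) else 0) *
        (((((σ 0 k : ℝ) ^ Aτ)⁻¹ : ℝ)) : ℂ) = 0 := fun n hn => by rw [if_neg hn, zero_mul]
    have hmain := HC (x / k) hxk₀ M (N / k) S Rd Y hMN' hN' hNS' hS' hSx' hRd1 hRd' hY1' hY4 a₁
      ((k : ℤ) * a₂) ha₁ hka0 ha₁' hka₂' α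
      (fun n => (if Squarefree n then β (k * n) else 0) * (((((σ 0 k : ℝ) ^ Aτ)⁻¹ : ℝ)) : ℂ))
      hα hβ' hβ's
    refine hmain.trans ?_
    rw [div_le_div_iff_of_pos_right hRd0]
    have hLc : Real.log (x / k) ^ c₀ ≤ Real.log x ^ max c₀ 0 :=
      (Real.rpow_le_rpow_of_exponent_le hlogk1 (le_max_left _ _)).trans
        (Real.rpow_le_rpow (by linarith) hlogk (le_max_right _ _))
    calc C * (x / k) * Real.log (x / k) ^ c₀ ≤ max C 0 * (x / k) * Real.log (x / k) ^ c₀ := by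
          gcongr; exact le_max_left _ _
      _ ≤ max C 0 * (x / k) * Real.log x ^ max c₀ 0 :=
          mul_le_mul_of_nonneg_left hLc (by positivity)
  -- ### summing the head over `k`
  have hsumτ : ∑ k ∈ (Icc 1 ⌊K⌋₊).filter (fun k : ℕ => ∀ p ∈ k.primeFactors, p ^ 2 ∣ k),
      (σ 0 k : ℝ) ^ Aτ / k ≤ 9 * Cτ ^ Aτ := by
    have hεA : ε * Aτ ≤ 1 / 4 := by
      rw [hε, div_mul_eq_mul_div, div_le_iff₀ (by positivity)]
      have hκ1 : κ ≤ 1 := by linarith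
      have : κ * Aτ ≤ 1 * Aτ := mul_le_mul_of_nonneg_right hκ1 hAτ
      linarith
    have h1 : ∀ k ∈ (Icc 1 ⌊K⌋₊).filter (fun k : ℕ => ∀ p ∈ k.primeFactors, p ^ 2 ∣ k),
        (σ 0 k : ℝ) ^ Aτ / k ≤ Cτ ^ Aτ * (k : ℝ) ^ (-(3 / 4 : ℝ)) := by
      intro k hk
      rw [Finset.mem_filter, Finset.mem_Icc] at hk
      have hk0' : (0 : ℝ) < k := by exact_mod_cast hk.1.1
      have hk1' : (1 : ℝ) ≤ k := by exact_mod_cast hk.1.1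
      have h2 : (σ 0 k : ℝ) ^ Aτ ≤ Cτ ^ Aτ * (k : ℝ) ^ (1 / 4 : ℝ) := by
        calc (σ 0 k : ℝ) ^ Aτ ≤ (Cτ * (k : ℝ) ^ ε) ^ Aτ :=
              Real.rpow_le_rpow (Nat.cast_nonneg _) (by exact_mod_cast hCτ k) hAτ
          _ = Cτ ^ Aτ * (k : ℝ) ^ (ε * Aτ) := by
              rw [Real.mul_rpow hCτ0.le (by positivity), ← Real.rpow_mul hk0'.le]
          _ ≤ Cτ ^ Aτ * (k : ℝ) ^ (1 / 4 : ℝ) :=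
              mul_le_mul_of_nonneg_left (Real.rpow_le_rpow_of_exponent_le hk1' hεA) (by positivity)
      rw [div_le_iff₀ hk0']
      calc (σ 0 k : ℝ) ^ Aτ ≤ Cτ ^ Aτ * (k : ℝ) ^ (1 / 4 : ℝ) := h2
        _ = Cτ ^ Aτ * (k : ℝ) ^ (-(3 / 4 : ℝ)) * k := by
            rw [mul_assoc]
            congr 1
            conv_rhs => rw [show (k : ℝ) ^ (-(3 / 4 : ℝ)) * k = (k : ℝ) ^ (-(3 / 4 : ℝ)) * (k : ℝ) ^ (1 : ℝ) by
              rw [Real.rpow_one]]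
            rw [← Real.rpow_add hk0']; norm_num
    calc ∑ k ∈ (Icc 1 ⌊K⌋₊).filter (fun k : ℕ => ∀ p ∈ k.primeFactors, p ^ 2 ∣ k), (σ 0 k : ℝ) ^ Aτ / k
        ≤ ∑ k ∈ (Icc 1 ⌊K⌋₊).filter (fun k : ℕ => ∀ p ∈ k.primeFactors, p ^ 2 ∣ k),
            Cτ ^ Aτ * (k : ℝ) ^ (-(3 / 4 : ℝ)) := Finset.sum_le_sum h1
      _ ≤ ∑ c ∈ Icc 1 ⌊K⌋₊, ∑ a ∈ Icc 1 ⌊K⌋₊, Cτ ^ Aτ * (((c ^ 2 * a ^ 3 : ℕ)) : ℝ) ^ (-(3 / 4 : ℝ)) :=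
          sum_filter_squarefull_le ⌊K⌋₊ (g := fun k : ℕ => Cτ ^ Aτ * (k : ℝ) ^ (-(3 / 4 : ℝ)))
            fun k => by positivity
      _ ≤ ∑ c ∈ Icc 1 ⌊K⌋₊, ∑ a ∈ Icc 1 ⌊K⌋₊,
            Cτ ^ Aτ * (1 / (((c : ℝ) * Real.sqrt c) * ((a : ℝ) * Real.sqrt a))) := by
          refine Finset.sum_le_sum fun c hc => Finset.sum_le_sum fun a ha => ?_
          exact mul_le_mul_of_nonneg_left (rpow_neg_three_quarters_le (Finset.mem_Icc.1 hc).1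
            (Finset.mem_Icc.1 ha).1) (by positivity)
      _ = Cτ ^ Aτ * ∑ c ∈ Icc 1 ⌊K⌋₊, ∑ a ∈ Icc 1 ⌊K⌋₊,
            1 / (((c : ℝ) * Real.sqrt c) * ((a : ℝ) * Real.sqrt a)) := by
          rw [Finset.mul_sum]; simp_rw [Finset.mul_sum]
      _ ≤ Cτ ^ Aτ * 9 := mul_le_mul_of_nonneg_left (sum_box_le_nine _) (by positivity)
      _ = 9 * Cτ ^ Aτ := by ring
  have hhead : ‖∑ s ∈ (BFI.mRange S Y).filter (fun s : ℕ => IsCoprime (s : ℤ) (a₁ * a₂)),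
      ((BFI.bump S Y s : ℝ) : ℂ) *
        ∑ m ∈ BFI.dyadic M, ∑ n ∈ (BFI.dyadic N).filter (fun n : ℕ => IsCoprime (n : ℤ) a₂),
          α m * (if (powerfulPart n : ℝ) ≤ K then β n else 0) *
            uR Rd s (((m * n : ℕ) : ZMod s) * ((a₁ : ZMod s))⁻¹ * ((a₂ : ZMod s)))‖ ≤
      9 * Cτ ^ Aτ * max C 0 * x * Real.log x ^ max c₀ 0 / Rd := by
    rw [hhead_eq]
    refine (norm_sum_le _ _).trans ((Finset.sum_le_sum hJ).trans ?_)
    have hk : ∀ k ∈ (Icc 1 ⌊K⌋₊).filter (fun k : ℕ => ∀ p ∈ k.primeFactors, p ^ 2 ∣ k),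
        (σ 0 k : ℝ) ^ Aτ * (max C 0 * (x / k) * Real.log x ^ max c₀ 0 / Rd) =
          (max C 0 * x * Real.log x ^ max c₀ 0 / Rd) * ((σ 0 k : ℝ) ^ Aτ / k) := by
      intro k hk
      rw [Finset.mem_filter, Finset.mem_Icc] at hk
      have hk0' : (k : ℝ) ≠ 0 := by exact_mod_cast (by omega : k ≠ 0)
      field_simp
    rw [Finset.sum_congr rfl hk, ← Finset.mul_sum]
    have h0 : 0 ≤ max C 0 * x * Real.log x ^ max c₀ 0 / Rd := by
      have : 0 ≤ max C 0 := le_max_right _ _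
      positivity
    calc (max C 0 * x * Real.log x ^ max c₀ 0 / Rd) *
          ∑ k ∈ (Icc 1 ⌊K⌋₊).filter (fun k : ℕ => ∀ p ∈ k.primeFactors, p ^ 2 ∣ k), (σ 0 k : ℝ) ^ Aτ / k
        ≤ (max C 0 * x * Real.log x ^ max c₀ 0 / Rd) * (9 * Cτ ^ Aτ) :=
          mul_le_mul_of_nonneg_left hsumτ h0
      _ = _ := by ring
  -- ### conclusion
  have hLc1 : 1 ≤ Real.log x ^ max c₀ 0 := Real.one_le_rpow hL1 (le_max_right _ _)
  have htail'' : 1296 * Cτ ^ (2 * Aτ + 2) * x / Rd ≤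
      1296 * Cτ ^ (2 * Aτ + 2) * x * Real.log x ^ max c₀ 0 / Rd := by
    rw [div_le_div_iff_of_pos_right hRd0]
    calc 1296 * Cτ ^ (2 * Aτ + 2) * x = 1296 * Cτ ^ (2 * Aτ + 2) * x * 1 := by ring
      _ ≤ _ := mul_le_mul_of_nonneg_left hLc1 (by positivity)
  rw [hSS]
  refine (norm_add_le _ _).trans ?_
  calc _ ≤ 9 * Cτ ^ Aτ * max C 0 * x * Real.log x ^ max c₀ 0 / Rd +
        1296 * Cτ ^ (2 * Aτ + 2) * x * Real.log x ^ max c₀ 0 / Rd :=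
        add_le_add hhead (htail.trans (htail'.trans htail''))
    _ = (9 * Cτ ^ Aτ * max C 0 + 1296 * Cτ ^ (2 * Aτ + 2)) * x * Real.log x ^ max c₀ 0 / Rd := by
        ring

end Drappeau2017

open Drappeau2017 in
/-- **Drappeau 2017, §5.2: Theorem 5.1 follows from Proposition 5.3** (for the weights `BFI.bump`):
if the smoothed sum with `β` supported on squarefree integers is `≤ C x (log x)^{c₀}/Rd` under the
hypotheses of Theorem 5.1 and for every transition width `S x^{−δ} ≤ Y ≤ S/4`, then
`Drappeau2017_theorem51` holds — the two reductions `smooth_of_smooth_sqfree` and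
`Drappeau2017_theorem51_of_smooth` composed. [cite: Drappeau2017, §5.2] -/
theorem Drappeau2017_theorem51_of_smooth_sqfree
    (Hsq : ∀ η : ℝ, 0 < η → ∃ δ : ℝ, 0 < δ ∧ ∀ Aτ : ℝ, 0 ≤ Aτ → ∃ C c₀ x₀ : ℝ, ∀ x : ℝ, x₀ ≤ x →
      ∀ M N S Rd Y : ℝ, M * N = x → x ^ η ≤ N → N ≤ S ^ (2 / 3 - η) → x ^ (1 / 4 : ℝ) ≤ S →
        S ≤ x ^ (1 / 2 + δ) → 1 ≤ Rd → Rd ≤ x ^ δ → S * x ^ (-δ) ≤ Y → Y ≤ S / 4 →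
      ∀ a₁ a₂ : ℤ, a₁ ≠ 0 → a₂ ≠ 0 → (|a₁| : ℝ) ≤ x ^ δ → (|a₂| : ℝ) ≤ x ^ δ →
      ∀ α β : ℕ → ℂ, (∀ m, ‖α m‖ ≤ (σ 0 m : ℝ) ^ Aτ) → (∀ n, ‖β n‖ ≤ (σ 0 n : ℝ) ^ Aτ) →
        (∀ n, ¬Squarefree n → β n = 0) →
        ‖∑ s ∈ (BFI.mRange S Y).filter (fun s : ℕ => IsCoprime (s : ℤ) (a₁ * a₂)),
            ((BFI.bump S Y s : ℝ) : ℂ) *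
              ∑ m ∈ BFI.dyadic M, ∑ n ∈ (BFI.dyadic N).filter (fun n : ℕ => IsCoprime (n : ℤ) a₂),
                α m * β n *
                  uR Rd s (((m * n : ℕ) : ZMod s) * ((a₁ : ZMod s))⁻¹ * ((a₂ : ZMod s)))‖ ≤
          C * x * Real.log x ^ c₀ / Rd) :
    Drappeau2017_theorem51 :=
  Drappeau2017_theorem51_of_smooth (smooth_of_smooth_sqfree Hsq)

end Literature.NumberTheory.Sieve

end
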